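import Mathlib
import HarnessLib
import Summits.Ventures.LatticeQCDFlow.Scaling.SU3HaarSmallBallUpper
import Literature.Combinatorics.SimpleGraph.CycleSpectrum

/-!
# LatticeQCDFlow / Scaling — explicit SU(3) small-ball mass from ABOVE at the sharp order:
# `Haar{3 − Re tr U ≤ η} ≤ (256/3)·η⁴` (`η ≤ 1`) and `Haar{‖U − 1‖_F ≤ r} ≤ (16/3)·r⁸` (`r² ≤ 2`)

HONEST FRAMING: exact (Metropolis-corrected) sampling algorithms for lattice gauge theory;
figures of merit are autocorrelation/cost numbers at stated couplings and volumes; no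
continuum-physics claim.

Venture `LatticeQCDFlow` (cell pub-lqcd), topic `Scaling`, FANOUT row 30 (lean-1, GEN-22) — OUR WORK:
`Scaling/SU3HaarSmallBallUpper` bounded `Haar{3 − Re tr U ≤ η}` by `(256/3)·η³` from the pointwise bound
`|Δ|² ≤ 64·(3 − Re tr)³ ≤ 512η³` on the WHOLE maximal torus.  Here the AREA of the torus neighbourhood is
used as well: `3 − Re tr = (1 − cos θ₁) + (1 − cos θ₂) + (1 − cos(θ₁ + θ₂))` with non-negative terms, so the
majorant vanishes unless `1 − cos θ₁ < 2η` and `1 − cos θ₂ < 2η`; by Jordan's inequality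
(`Literature/…/CycleSpectrum.mul_sq_le_two_sub_two_mul_cos`: `(4/π²)q² ≤ 2 − 2cos q` on `|q| ≤ π`) and the
monotonicity of `cos` on `[0, π]`, `1 − cos θ ≥ 2η` on `[π√η, 2π − π√η]`, so each angle is confined to two
intervals of length `π√η`: the double integral is at most `512η³·(2π√η)² = 2048π²η⁴`, i.e.
`Haar{3 − Re tr U ≤ η} ≤ (256/3)·η⁴ ≍ η^{dim SU(3)/2}` — the order of the truth (the lower bound of
`Scaling/SU3HaarSmallBall` is `η⁴/(4000π⁸)`).  Downstream (separate file) this raises the logarithmic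
coefficient of the `SU(3)` volume law from `3` to `dim SU(3)/2 = 4`.

## What is proved (all [ours])

* §1 `one_sub_cos_le_of_mem_Icc_two_pi_sub` (`a ≤ θ ≤ 2π − a`, `0 ≤ a` ⇒ `1 − cos a ≤ 1 − cos θ`),
  `two_mul_le_one_sub_cos_pi_mul_sqrt` (`0 ≤ η ≤ 1` ⇒ `2η ≤ 1 − cos(π√η)`),
  `intervalIntegral_le_two_mul_of_vanishing_middle` (a continuous `f ≤ c` on `[0, 2π]` with `f ≤ 0` on
  `[a, 2π − a]`, `0 ≤ a ≤ π`: `∫₀^{2π} f ≤ 2·c·a`).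
* §2 **`torusIntegral_majorant_le_sharp`** — `0 < η ≤ 1`:
  `(1/(24π²))∫₀^{2π}∫₀^{2π} g_η(reTrSU3)·|Δ|² ≤ (256/3)·η⁴`;
  **`haar_su3_three_sub_trace_le_le_sharp`** — `Haar{U ∈ SU(3) : 3 − Re tr U ≤ η} ≤ (256/3)·η⁴`.
* §3 **`haarProbability_real_ball_le_su3_sharp`** — `0 < r`, `r² ≤ 2`:
  `Haar{‖fundamentalRep (Fin 3) U − 1‖_F ≤ r} ≤ (16/3)·r⁸`.

No `def`, no `sorry`, nothing cited as a fact beyond the tree.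
-/

noncomputable section

namespace Summit.Ventures.LatticeQCDFlow.Theory2.WeakCoupling

open MeasureTheory Real intervalIntegral Set
open Summit.Ventures.LatticeQCDFlow.Scoring
open Literature.MathematicalPhysics.QuantumFieldTheory Literature.MathematicalPhysics.QuantumLattice
open scoped Matrix Matrix.Norms.Frobenius

/-! ## §1 The torus neighbourhood is thin -/

/-- On `[a, 2π − a]` (`0 ≤ a`) the cosine is at most `cos a`: `1 − cos a ≤ 1 − cos θ`. [folklore] -/
theorem one_sub_cos_le_of_mem_Icc_two_pi_sub {a θ : ℝ} (ha0 : 0 ≤ a) (h1 : a ≤ θ) (h2 : θ ≤ 2 * π - a) :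
    1 - Real.cos a ≤ 1 - Real.cos θ := by
  by_cases hθ : θ ≤ π
  · have := Real.cos_le_cos_of_nonneg_of_le_pi ha0 hθ h1
    linarith
  · rw [not_le] at hθ
    have e : Real.cos θ = Real.cos (2 * π - θ) := by
      rw [Real.cos_sub, Real.cos_two_pi, Real.sin_two_pi]; ring
    have h3 : a ≤ 2 * π - θ := by linarith
    have h4 : 2 * π - θ ≤ π := by linarith
    have := Real.cos_le_cos_of_nonneg_of_le_pi ha0 h4 h3
    linarith

/-- Jordan at the radius `π√η`: `0 ≤ η ≤ 1` ⇒ `2η ≤ 1 − cos(π√η)`. [folklore] -/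
theorem two_mul_le_one_sub_cos_pi_mul_sqrt {η : ℝ} (hη0 : 0 ≤ η) (hη1 : η ≤ 1) :
    2 * η ≤ 1 - Real.cos (π * Real.sqrt η) := by
  have hπ := Real.pi_pos
  have hs1 : Real.sqrt η ≤ 1 := by
    have := Real.sqrt_le_sqrt hη1
    rwa [Real.sqrt_one] at this
  have habs : |π * Real.sqrt η| ≤ π := by
    rw [abs_of_nonneg (by positivity)]
    nlinarith [Real.sqrt_nonneg η]
  have hJ := Literature.Combinatorics.SimpleGraph.mul_sq_le_two_sub_two_mul_cos habs
  have e : 4 / π ^ 2 * (π * Real.sqrt η) ^ 2 = 4 * η := by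
    rw [mul_pow, Real.sq_sqrt hη0]; field_simp
  rw [e] at hJ
  linarith

/-- **A continuous function bounded by `c ≥ 0` on `[0, 2π]` and non-positive on `[a, 2π − a]`
(`0 ≤ a ≤ π`) has `∫₀^{2π} f ≤ 2·c·a`.** [folklore] -/
theorem intervalIntegral_le_two_mul_of_vanishing_middle {f : ℝ → ℝ} {a c : ℝ} (hf : Continuous f)
    (ha0 : 0 ≤ a) (haπ : a ≤ π) (hfc : ∀ x ∈ Icc (0 : ℝ) (2 * π), f x ≤ c)
    (hf0 : ∀ x ∈ Icc a (2 * π - a), f x ≤ 0) :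
    ∫ x in (0 : ℝ)..2 * π, f x ≤ 2 * c * a := by
  have hπ := Real.pi_pos
  have h1 : ∫ x in (0 : ℝ)..a, f x ≤ c * (a - 0) :=
    intervalIntegral_le_mul_of_le hf ha0 (fun x hx => hfc x ⟨hx.1, by linarith [hx.2]⟩)
  have h2 : ∫ x in a..2 * π - a, f x ≤ 0 * (2 * π - a - a) :=
    intervalIntegral_le_mul_of_le hf (by linarith) (fun x hx => hf0 x hx)
  have h3 : ∫ x in (2 * π - a)..2 * π, f x ≤ c * (2 * π - (2 * π - a)) :=
    intervalIntegral_le_mul_of_le hf (by linarith) (fun x hx => hfc x ⟨by linarith [hx.1], hx.2⟩)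
  have hsplit : ∫ x in (0 : ℝ)..2 * π, f x =
      (∫ x in (0 : ℝ)..a, f x) + (∫ x in a..2 * π - a, f x) + ∫ x in (2 * π - a)..2 * π, f x := by
    rw [intervalIntegral.integral_add_adjacent_intervals (hf.intervalIntegrable _ _) (hf.intervalIntegrable _ _),
      intervalIntegral.integral_add_adjacent_intervals (hf.intervalIntegrable _ _) (hf.intervalIntegrable _ _)]
  rw [hsplit]
  nlinarith

/-! ## §2 The small-ball bound in the trace variable, sharp order -/

/-- The torus side at the sharp order: for `0 < η ≤ 1`, with `g_η(t) = min 1 (max 0 ((t − (3 − 2η))/η))`,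
`(1/(24π²))∫₀^{2π}∫₀^{2π} g_η(reTrSU3)·|Δ|² ≤ (256/3)·η⁴`. [ours] -/
theorem torusIntegral_majorant_le_sharp {η : ℝ} (hη0 : 0 < η) (hη1 : η ≤ 1) :
    1 / (6 * (2 * π) ^ 2) * ∫ θ₁ in (0 : ℝ)..2 * π, ∫ θ₂ in (0 : ℝ)..2 * π,
      min 1 (max 0 ((reTrSU3 θ₁ θ₂ - (3 - 2 * η)) / η)) * weylSU3 θ₁ θ₂ ≤ 256 / 3 * η ^ 4 := by
  have hπ := Real.pi_pos
  set a : ℝ := π * Real.sqrt η with ha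
  have ha0 : 0 ≤ a := by positivity
  have hs1 : Real.sqrt η ≤ 1 := by
    have := Real.sqrt_le_sqrt hη1
    rwa [Real.sqrt_one] at this
  have haπ : a ≤ π := by rw [ha]; nlinarith [Real.sqrt_nonneg η]
  have ha2 : a ^ 2 = π ^ 2 * η := by rw [ha, mul_pow, Real.sq_sqrt hη0.le]
  have hcosA : 2 * η ≤ 1 - Real.cos a := two_mul_le_one_sub_cos_pi_mul_sqrt hη0.le hη1
  set g : ℝ → ℝ := fun t => min 1 (max 0 ((t - (3 - 2 * η)) / η)) with hg
  have hg0 : ∀ t : ℝ, 0 ≤ g t := fun t => le_min zero_le_one (le_max_left _ _)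
  have hg1 : ∀ t : ℝ, g t ≤ 1 := fun t => min_le_left _ _
  have hgzero : ∀ t : ℝ, t ≤ 3 - 2 * η → g t = 0 := by
    intro t ht
    have hneg : (t - (3 - 2 * η)) / η ≤ 0 := div_nonpos_of_nonpos_of_nonneg (by linarith) hη0.le
    simp only [hg]
    rw [max_eq_left hneg, min_eq_right zero_le_one]
  -- pointwise ceiling `512 η³` (as in the cube file)
  have hpt : ∀ θ₁ θ₂ : ℝ, g (reTrSU3 θ₁ θ₂) * weylSU3 θ₁ θ₂ ≤ 512 * η ^ 3 := by
    intro θ₁ θ₂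
    by_cases h : reTrSU3 θ₁ θ₂ ≤ 3 - 2 * η
    · rw [hgzero _ h, zero_mul]; positivity
    · rw [not_le] at h
      have hS : 3 - reTrSU3 θ₁ θ₂ ≤ 2 * η := by linarith
      have hS0 : 0 ≤ 3 - reTrSU3 θ₁ θ₂ := by
        unfold reTrSU3
        linarith [Real.cos_le_one θ₁, Real.cos_le_one θ₂, Real.cos_le_one (θ₁ + θ₂)]
      have hw : weylSU3 θ₁ θ₂ ≤ 64 * (2 * η) ^ 3 :=
        (weylSU3_le_mul_cube θ₁ θ₂).trans (by gcongr)
      calc g (reTrSU3 θ₁ θ₂) * weylSU3 θ₁ θ₂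
          ≤ 1 * (64 * (2 * η) ^ 3) := mul_le_mul (hg1 _) hw (weylSU3_nonneg _ _) zero_le_one
        _ = 512 * η ^ 3 := by ring
  -- vanishing: if one angle lies in `[a, 2π − a]` the majorant is zero
  have hvan₂ : ∀ θ₁ θ₂ : ℝ, θ₂ ∈ Icc a (2 * π - a) → g (reTrSU3 θ₁ θ₂) * weylSU3 θ₁ θ₂ ≤ 0 := by
    intro θ₁ θ₂ hθ₂
    have hc := one_sub_cos_le_of_mem_Icc_two_pi_sub ha0 hθ₂.1 hθ₂.2
    have hle : reTrSU3 θ₁ θ₂ ≤ 3 - 2 * η := by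
      unfold reTrSU3
      linarith [Real.cos_le_one θ₁, Real.cos_le_one (θ₁ + θ₂)]
    rw [hgzero _ hle, zero_mul]
  have hvan₁ : ∀ θ₁ θ₂ : ℝ, θ₁ ∈ Icc a (2 * π - a) → g (reTrSU3 θ₁ θ₂) * weylSU3 θ₁ θ₂ ≤ 0 := by
    intro θ₁ θ₂ hθ₁
    have hc := one_sub_cos_le_of_mem_Icc_two_pi_sub ha0 hθ₁.1 hθ₁.2
    have hle : reTrSU3 θ₁ θ₂ ≤ 3 - 2 * η := by
      unfold reTrSU3
      linarith [Real.cos_le_one θ₂, Real.cos_le_one (θ₁ + θ₂)]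
    rw [hgzero _ hle, zero_mul]
  have hgc : Continuous g :=
    continuous_const.min (continuous_const.max ((continuous_id.sub continuous_const).div_const _))
  have hhc : Continuous fun p : ℝ × ℝ =>
      (fun θ₁ θ₂ : ℝ => g (reTrSU3 θ₁ θ₂) * weylSU3 θ₁ θ₂) p.1 p.2 :=
    (hgc.comp (continuous_reTrSU3_comp continuous_fst continuous_snd)).mul
      (continuous_weylSU3_comp continuous_fst continuous_snd)
  have hc1 : ∀ θ₁ : ℝ, Continuous fun θ₂ : ℝ => g (reTrSU3 θ₁ θ₂) * weylSU3 θ₁ θ₂ := fun θ₁ =>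
    (hgc.comp (continuous_reTrSU3_comp continuous_const continuous_id)).mul
      (continuous_weylSU3_comp continuous_const continuous_id)
  -- inner integral: `≤ 2·512η³·a` always, `≤ 0` when `θ₁ ∈ [a, 2π − a]`
  have hinner : ∀ θ₁ : ℝ,
      ∫ θ₂ in (0 : ℝ)..2 * π, g (reTrSU3 θ₁ θ₂) * weylSU3 θ₁ θ₂ ≤ 2 * (512 * η ^ 3) * a := fun θ₁ =>
    intervalIntegral_le_two_mul_of_vanishing_middle (hc1 θ₁) ha0 haπ
      (fun θ₂ _ => hpt θ₁ θ₂) (fun θ₂ hθ₂ => hvan₂ θ₁ θ₂ hθ₂)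
  have hinner0 : ∀ θ₁ ∈ Icc a (2 * π - a),
      ∫ θ₂ in (0 : ℝ)..2 * π, g (reTrSU3 θ₁ θ₂) * weylSU3 θ₁ θ₂ ≤ 0 := by
    intro θ₁ hθ₁
    have h := intervalIntegral_le_mul_of_le (hc1 θ₁) (by positivity : (0 : ℝ) ≤ 2 * π)
      (c := 0) (fun θ₂ _ => hvan₁ θ₁ θ₂ hθ₁)
    simpa using h
  -- outer integral
  have hφc : Continuous fun θ₁ : ℝ => ∫ θ₂ in (0 : ℝ)..2 * π, g (reTrSU3 θ₁ θ₂) * weylSU3 θ₁ θ₂ :=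
    continuous_inner_integral (g := fun θ₁ θ₂ : ℝ => g (reTrSU3 θ₁ θ₂) * weylSU3 θ₁ θ₂) hhc 0 (2 * π)
  have houter : ∫ θ₁ in (0 : ℝ)..2 * π, ∫ θ₂ in (0 : ℝ)..2 * π, g (reTrSU3 θ₁ θ₂) * weylSU3 θ₁ θ₂ ≤
      2 * (2 * (512 * η ^ 3) * a) * a :=
    intervalIntegral_le_two_mul_of_vanishing_middle hφc ha0 haπ
      (fun θ₁ _ => hinner θ₁) hinner0
  calc 1 / (6 * (2 * π) ^ 2) * ∫ θ₁ in (0 : ℝ)..2 * π, ∫ θ₂ in (0 : ℝ)..2 * π,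
        g (reTrSU3 θ₁ θ₂) * weylSU3 θ₁ θ₂
      ≤ 1 / (6 * (2 * π) ^ 2) * (2 * (2 * (512 * η ^ 3) * a) * a) :=
        mul_le_mul_of_nonneg_left houter (by positivity)
    _ = 2048 / (24 * π ^ 2) * η ^ 3 * a ^ 2 := by field_simp; ring
    _ = 256 / 3 * η ^ 4 := by rw [ha2]; field_simp; ring

/-- **`Haar{U ∈ SU(3) : 3 − Re tr U ≤ η} ≤ (256/3)·η⁴`** for `0 < η ≤ 1` — the order of the truth
(`η⁴ ≍ r⁸ = r^{dim SU(3)}`). [ours] -/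
theorem haar_su3_three_sub_trace_le_le_sharp {η : ℝ} (hη0 : 0 < η) (hη1 : η ≤ 1) :
    (haarProbability (Matrix.specialUnitaryGroup (Fin 3) ℂ)).real
        {U : Matrix.specialUnitaryGroup (Fin 3) ℂ | 3 - ((U : Matrix (Fin 3) (Fin 3) ℂ).trace).re ≤ η} ≤
      256 / 3 * η ^ 4 := by
  have hgc : Continuous fun t : ℝ => min 1 (max 0 ((t - (3 - 2 * η)) / η)) :=
    continuous_const.min (continuous_const.max ((continuous_id.sub continuous_const).div_const _))
  have hweyl := SU3Haar.integral_haar_su3_traceFun_eq_integral2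
    (fun t : ℝ => min 1 (max 0 ((t - (3 - 2 * η)) / η))) hgc
  beta_reduce at hweyl
  exact (haar_real_le_integral_majorant hη0).trans (hweyl ▸ torusIntegral_majorant_le_sharp hη0 hη1)

/-! ## §3 The Frobenius-ball form -/

/-- **`Haar{U ∈ SU(3) : ‖U − 1‖_F ≤ r} ≤ (16/3)·r⁸`** for `0 < r`, `r² ≤ 2` (`‖U − 1‖_F² = 2(3 − Re tr U)`).
[ours] -/
theorem haarProbability_real_ball_le_su3_sharp {r : ℝ} (hr : 0 < r) (hr2 : r ^ 2 ≤ 2) :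
    (haarProbability (Matrix.specialUnitaryGroup (Fin 3) ℂ)).real
        {U : Matrix.specialUnitaryGroup (Fin 3) ℂ | ‖fundamentalRep (Fin 3) U - 1‖ ≤ r} ≤ 16 / 3 * r ^ 8 := by
  have hη0 : 0 < r ^ 2 / 2 := by positivity
  have hη1 : r ^ 2 / 2 ≤ 1 := by linarith
  have hsub : {U : Matrix.specialUnitaryGroup (Fin 3) ℂ | ‖fundamentalRep (Fin 3) U - 1‖ ≤ r} ⊆
      {U : Matrix.specialUnitaryGroup (Fin 3) ℂ |
        3 - ((U : Matrix (Fin 3) (Fin 3) ℂ).trace).re ≤ r ^ 2 / 2} := by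
    intro U hU
    have hU' : ‖fundamentalRep (Fin 3) U - 1‖ ≤ r := hU
    have hid := sub_re_trace_eq_half_norm_sub_one_sq (fundamentalRep_mem_unitaryGroup U)
    rw [fundamentalRep_apply] at hid hU'
    have hsq : ‖(U : Matrix (Fin 3) (Fin 3) ℂ) - 1‖ ^ 2 ≤ r ^ 2 := pow_le_pow_left₀ (norm_nonneg _) hU' 2
    show (3 : ℝ) - ((U : Matrix (Fin 3) (Fin 3) ℂ).trace).re ≤ r ^ 2 / 2
    have h3 : ((3 : ℕ) : ℝ) = 3 := by norm_num
    rw [h3] at hid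
    linarith
  have h := haar_su3_three_sub_trace_le_le_sharp hη0 hη1
  have e : (256 : ℝ) / 3 * (r ^ 2 / 2) ^ 4 = 16 / 3 * r ^ 8 := by ring
  rw [← e]
  exact (measureReal_mono hsub).trans h

end Summit.Ventures.LatticeQCDFlow.Theory2.WeakCoupling

end
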